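import Literature.MathematicalPhysics.QuantumFieldTheory.Balaban1983to89.B8Thm2TorusKnitParamsExist
import Literature.MathematicalPhysics.QuantumFieldTheory.Balaban1983to89.T3SectALandauChart

/-!
# `Balaban1983to89.B8Thm2T3FamilyBinder` — M5.9 ASSEMBLY, FILE A13: the endpoint of files A11∕A12 READ IN THE VOCABULARY OF THE CONSUMER's BINDER —
# [Balaban1985RegularSpaces] THM 2 at the `SU(2)`-valued Setup-torus objects of the members `F.P K` of a T³ family `F : T3Family` ([Balaban1985UV3] (1)–(3)
# p. 256: `d = 3`, block size `L`, volume exponent `m`, `K` steps), at print's `η = L^{−(K−n)}` ([Balaban1985Variational] (2), (5) p. 278), in the shape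
# `∀ F, F.L = L → ∀ n K, n < K → ∃ β₀ B₂ len, Thm2SetupSUAt (F.P K) 2 (K − n) (eta F n K) β₀ B₁ B₂ c₁ len (fun _ => True)` with `B₁, c₁` uniform — modulo the
# two displayed arrows (analytic cube data, (B)-lines) and the LOCATED VOLUME THRESHOLD `k₀ ≤ F.m`

T. Bałaban, *Spaces of regular gauge field configurations on a lattice and gauge fixing conditions*, Commun. Math. Phys. **99** (1985) 75–102
[Balaban1985RegularSpaces] («[B8]»), THM 2 p. 83; T. Bałaban, *Ultraviolet stability of three-dimensional lattice pure gauge field theories*, Commun. Math.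
Phys. **102** (1985) 255–275 [Balaban1985UV3], (1)–(3) p. 256 (the family of lattice approximations on the three-torus); T. Bałaban, *The variational problem
and background fields in renormalization group method for lattice gauge theories*, Commun. Math. Phys. **102** (1985) 277–309 [Balaban1985Variational], (2), (5)
p. 278 (`η = L^{−k}`); [Balaban1985BackgroundPropagators] Thm 3.7 p. 410 ∕ Thm 3.9 p. 413; [Balaban1984PropagatorsII] (2.1)–(2.4) p. 224.

Sub-row G-B8-T2S «[B8] §3 Thm 2 TORUS SUPPLIER» (unit `lit-balaban-t2s-1`, gen 5).  The consumer of this sub-row's currency is the binder `hThm2` of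
`Summit.QuantumFields.YangMills.Theorems.Prop7SPrintThm2Dict.prop2Printed_sPrint_of_thm2SetupSUAt` (stmt-QuantumFields-19200's cone): `∀ (F : T3Family),
F.L = L → ∀ (n K : ℕ), n < K → ∃ (β₀ B₂ : ℝ) (len : LSite (F.P K).d → ℝ), Thm2SetupSUAt (F.P K) 2 (K - n) (eta F n K) β₀ B₁ B₂ c₁ len (fun _ => True)` with
`B₁, c₁ > 0` uniform.  File A12's `thm2SetupSUAt_catalogued_exists_of_constants` supplies `Thm2SetupSUAt (PV d ℓ m K hd hL) N k η 0 B₁ B₂ c₁ len (fun _ => True)`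
for every `m K k η` with `1 ≤ k`, `k + k₀ ≤ m + K`, `η > 0`, modulo the analytic cube data and the (B)-lines.  THIS FILE (one theorem, plumbing only) reads
that endpoint at `d + 1 = 3`, `N = 2`, `m := F.m`, `k := K − n`, `η := eta F n K = L^{−(K−n)}`: the member `F.P K = params3 F.L F.hL F.m K` of a family with
`F.L = ℓ + 1` IS the V1 record `PV 2 ℓ F.m K hd hL` (definitionally, after substituting `F.L`), `1 ≤ K − n` from `n < K`, and the volume threshold
`(K − n) + k₀ ≤ F.m + K` from **`k₀ ≤ F.m`** — the located caveat of file A11 now stated in the consumer's own terms: the binder is supplied for the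
families whose unit torus `T₁` has at least `2L^{k₀}` sites per direction («volume sufficiently large» relative to the cube size `M` of
[Balaban1985BackgroundPropagators] Thm 3.1 ∕ [Balaban1984PropagatorsII] Lemma 2.1; `T3Family` itself only carries `1 ≤ m`).

* ★★★★★★★ **`hThm2_of_constants`** — GIVEN odd `L = ℓ + 1 ≥ 5`, a band `0 < b₀ ≤ b₁`, (B)-line constants `B₀ ≥ 2∕(15L)`, `B₀β`, `c_B9 > 0`, `β_H`, `len`, a
  real basis `b` of `M₂(ℂ)` with `M₂`-bounded coordinates and the `M`-independent constants of the analytic data (file A12): ∃ thresholds `θ_*, ℓ_* > 0`, `D_*`,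
  radius `c_L > 0`, targets `A, δ_G, δ₀`, and for every admissible `(θ, ℓ₀, ℓ₁, D_sep)` a record `p` (prescribed fields), a catalogue `k₀, mem, ιBm` and
  UNIFORM `B₁, B₂, c₁ > 0` such that FOR EVERY `F : T3Family` with `F.L = ℓ + 1` and `k₀ ≤ F.m`, every `n < K`: [analytic cube data at the members
  `mem P₀ j`, `j ≤ K − n`, every `SU(2)`-valued `P₀`-periodic `U₀ ∈ 𝔄_j(T_η, α₀)`, `α₀ ≤ c_L`, `η = eta F n K`] → [(B)-lines `B9P3PerAt` at `η = eta F n K`]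
  → `∃ β₀ B₂′ len′, Thm2SetupSUAt (F.P K) 2 (K − n) (eta F n K) β₀ B₁ B₂′ c₁ len′ (fun _ => True)` (`β₀ = 0`, `B₂′ = B₂`, `len′ = len`).

HONEST SCOPE.  Plumbing only (instantiation of file A12 + the definitional identification `F.P K = PV 2 ℓ F.m K`); NO estimate of [B8]∕[B9] is proved; the
analytic cube data and the (B)-lines stay DISPLAYED antecedents, inhabited by nothing here; the volume threshold `k₀ ≤ F.m` is DISPLAYED (not discharged,
not hidden); nothing under `Summits/` is touched and the consumer's binder (all `F` with `F.L = L`, no volume threshold) is NOT supplied as printed there;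
count-neutral; N05 ∕ `stub_PV3A` NOT discharged; nothing continuum ∕ ℝ⁴ ∕ OS ∕ mass-gap ∕ Clay — the Yang–Mills mass gap is NOT proved.  No `sorry`, no
`axiom`, no `def`, no `… : Prop` fact, no `instance`, no `notation`.  NEW file; nothing landed is modified.  Seat `lit-balaban-t2s-1` gen 5, 2026-08-28.
-/

noncomputable section

open scoped BigOperators

namespace Literature.MathematicalPhysics.QuantumFieldTheory.Balaban1983to89.B8Thm2T3FamilyBinder

open Node00 B6KLevelCensusIndexV1 B9Eq39Adjoint
open B7Prop1Explicit renaming Site → LSite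
open B7Prop1Explicit (e)
open B9GeoNormsKLevelV1 (geo9K)
open B6GlobalChartV1 (PV)
open B6Ineq2142KLevelV1 (β)
open B8Ineq132 (InAk)
open B8Thm2TorusLettersPerOfKnit (bgY)
open B8Thm2TorusKnitEstimatesOfMajorants (B9P3PerAt)
open B8Thm2TorusKnitMajorantsOfCubes (KnitCubeParams)
open B8Thm2TorusKnitCubeGeometry (KnitCubeAnalytic)
open B8Thm2TorusKnitParamsExist (thm2SetupSUAt_catalogued_exists_of_constants)
open B7Prop2SpecialUnitary (specialUnitaryUnits)
open B8Thm2SetupTorus (Thm2SetupSUAt)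
open T3ContinuumYM3Torus (T3Family)
open T3SectALandauChart (eta eta_pos)
open scoped Matrix Matrix.Norms.L2Operator

variable {ℓ : ℕ} {hd : 1 ≤ 2 + 1} {hL : Odd (ℓ + 1) ∧ 1 < ℓ + 1} {b₀ b₁ : ℝ}

/-! ## §1 The member of a T³ family is the V1 record -/

/-- **`F.P K` IS `PV 2 ℓ F.m K`** for a family with `F.L = ℓ + 1` ([Balaban1985UV3] (1)–(3): `d = 3`, block size `L`, volume exponent `m`, `K` steps — the same
record as [Balaban1984PropagatorsII]'s global torus of dimension `2 + 1`). [cite: Balaban1985UV3, (1)–(3) p.256; Balaban1984PropagatorsII, (2.1)–(2.4) p.224] -/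
theorem P_eq_PV (F : T3Family) (hF : F.L = ℓ + 1) (K : ℕ) : F.P K = PV 2 ℓ F.m K hd hL := by
  obtain ⟨L', hL', m, hm⟩ := F
  subst hF
  rfl

/-! ## §2 ★★★★★★★ The consumer's binder, modulo the displayed arrows and the volume threshold -/

section Binder

variable [instF : ∀ i : KIdx 2 ℓ hd hL b₀ b₁, Fintype (geo9K i).Site] [∀ i : KIdx 2 ℓ hd hL b₀ b₁, DecidableEq (geo9K i).Site]

/-- ★★★★★★★ **THE `hThm2` BINDER OF THE 19200 DICTIONARY, FROM THE ANALYTIC CUBE DATA AND THE (B)-LINES, FOR THE FAMILIES WITH `k₀ ≤ F.m`.**  Given odd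
`L = ℓ + 1 ≥ 5`, a band `0 < b₀ ≤ b₁`, (B)-line constants (`B₀ ≥ 2∕(15L)`, `c_B9 > 0`), a real basis `b` of `M₂(ℂ)` with `M₂`-bounded coordinates and the
`M`-independent constants of the analytic cube data: THERE ARE thresholds `θ_*, ℓ_* > 0`, `D_*`, a radius `c_L > 0`, targets `A ≥ A_c`, `0 < δ_G ≤ δ_c`,
`0 < δ₀ ≤ δ_C`, and for every admissible `(θ, ℓ₀, ℓ₁, D_sep)` («M sufficiently large») a record `p : KnitCubeParams` (prescribed fields), a catalogue
`k₀, mem, ιBm` (spec of file A11) and UNIFORM `B₁, B₂, c₁ > 0` such that for EVERY `F : T3Family` with `F.L = ℓ + 1` and `k₀ ≤ F.m` and every `n < K`: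
analytic cube data at the members `mem P₀ j` (`j ≤ K − n`, `P₀ = 2L^{F.m+K}`, every `SU(2)`-valued `P₀`-periodic `U₀ ∈ 𝔄_j(T_η, α₀)`, `α₀ ≤ c_L`,
`η = L^{−(K−n)}`) → (B)-lines at `η` → `∃ β₀ B₂′ len′, Thm2SetupSUAt (F.P K) 2 (K − n) (eta F n K) β₀ B₁ B₂′ c₁ len′ (fun _ => True)`.  File A12's
endpoint at `d + 1 = 3`, `N = 2`, `m = F.m`, `k = K − n`, `η = eta F n K`, `β₀ = 0`; the two arrows' antecedents and the volume threshold are displayed,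
inhabited by nothing here; no estimate of [B8]∕[B9] proved; `stub_PV3A` NOT discharged; the Yang–Mills mass gap is NOT proved.
[cite: Balaban1985RegularSpaces, Thm 2 p.83 («there exists B₁»), (1.33)–(1.39) pp.82–83; Balaban1985UV3, (1)–(3) p.256; Balaban1985Variational, (2), (5) p.278; Balaban1985BackgroundPropagators, Thm 3.7 p.410, Thm 3.9 p.413; Balaban1984PropagatorsII, (2.1)–(2.4) p.224, Lemma 2.1 p.234] -/
theorem hThm2_of_constants (hℓ : 4 ≤ ℓ) (hb₀ : 0 < b₀) (hb₁ : b₀ ≤ b₁)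
    {B₀ B₀β cB9 βH : ℝ} {len : LSite (2 + 1) → ℝ}
    (hB₀ : 0 < B₀) (hB : 2 ≤ 5 * ((2 + 1 : ℕ) : ℝ) * ((ℓ + 1 : ℕ) : ℝ) * B₀) (hcB9 : 0 < cB9)
    {ι : Type} [Fintype ι] [DecidableEq ι] (b : Module.Basis ι ℝ (Matrix (Fin 2) (Fin 2) ℂ)) {M₂ : ℝ} (hM₂ : 0 ≤ M₂)
    (hrepr : ∀ (v : Matrix (Fin 2) (Fin 2) ℂ) (j : ι), |b.repr v j| ≤ M₂ * ‖v‖)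
    {BG₀ δG₀ NG NG' AE Ac δc BC δC Nn κD : ℝ} (hBG₀ : 0 ≤ BG₀) (hδG₀ : 0 < δG₀) (hNG : 0 ≤ NG) (hNG' : 0 ≤ NG')
    (hAE : 0 ≤ AE) (hAc : 0 ≤ Ac) (hδc : 0 < δc) (hBC : 0 ≤ BC) (hδC : 0 < δC) (hNn : 0 ≤ Nn) (hκD : 0 ≤ κD) (Rr : ℝ) (Hp : Prop) :
    letI : CStarAlgebra (Matrix (Fin 2) (Fin 2) ℂ) := {}
    ∃ θs ℓs Ds cL A δG δ₀ : ℝ, 0 < θs ∧ 0 < ℓs ∧ 0 < cL ∧ Ac ≤ A ∧ 0 < δG ∧ δG ≤ δc ∧ 0 < δ₀ ∧ δ₀ ≤ δC ∧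
      ∀ θG ℓ₀ ℓ₁ Dsep : ℝ, 0 ≤ θG → θG ≤ θs → 0 ≤ ℓ₀ → ℓ₀ ≤ ℓs → 0 ≤ ℓ₁ → ℓ₁ ≤ ℓs → Ds ≤ Dsep →
        ∃ p : KnitCubeParams,
          (p.BG₀ = BG₀ ∧ p.δG₀ = δG₀ ∧ p.NG = NG ∧ p.NG' = NG' ∧ p.AE = AE ∧ p.θG = θG ∧ p.A = A ∧ p.δG = δG ∧
            p.B₀ = BC ∧ p.δ₀ = δ₀ ∧ p.bb = 1 ∧ p.aD = 1 ∧ p.Nn = Nn ∧ p.κD = κD ∧ p.Dsep = Dsep ∧ p.ℓ₀ = ℓ₀ ∧ p.ℓ₁ = ℓ₁) ∧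
        ∃ (k₀ : ℕ) (mem : ℤ → ℕ → KIdx 2 ℓ hd hL b₀ b₁) (ιBm : ∀ P n, BlkY (mem P n) → IBondY (mem P n)) (B₁ B₂ c₁ : ℝ),
          0 < B₁ ∧ 0 < B₂ ∧ 0 < c₁ ∧
          (∀ (m K n : ℕ), 1 ≤ n → n + k₀ ≤ m + K →
            (mem (((PV 2 ℓ m K hd hL).sitesPerDir 0 : ℕ) : ℤ) n).m = m + K ∧ (mem (((PV 2 ℓ m K hd hL).sitesPerDir 0 : ℕ) : ℤ) n).K = 0 ∧
            (mem (((PV 2 ℓ m K hd hL).sitesPerDir 0 : ℕ) : ℤ) n).k = n + 1 ∧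
            (mem (((PV 2 ℓ m K hd hL).sitesPerDir 0 : ℕ) : ℤ) n).cf = (((ℓ + 1 : ℕ) : ℝ)) ^ (mem (((PV 2 ℓ m K hd hL).sitesPerDir 0 : ℕ) : ℤ) n).k ∧
            (∀ z : SiteY (mem (((PV 2 ℓ m K hd hL).sitesPerDir 0 : ℕ) : ℤ) n), levY (mem (((PV 2 ℓ m K hd hL).sitesPerDir 0 : ℕ) : ℤ) n) z = n) ∧
            ∀ t, β (mem (((PV 2 ℓ m K hd hL).sitesPerDir 0 : ℕ) : ℤ) n).hN (mem (((PV 2 ℓ m K hd hL).sitesPerDir 0 : ℕ) : ℤ) n).D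
              (mem (((PV 2 ℓ m K hd hL).sitesPerDir 0 : ℕ) : ℤ) n).hk (ιBm (((PV 2 ℓ m K hd hL).sitesPerDir 0 : ℕ) : ℤ) n t) = t) ∧
          ∀ F : T3Family, F.L = ℓ + 1 → k₀ ≤ F.m → ∀ (n K : ℕ), n < K →
            (∀ j, 1 ≤ j → j ≤ K - n → ∀ ⦃α₀ : ℝ⦄, 0 < α₀ → α₀ ≤ cL → ∀ U₀ : LSite (2 + 1) → Fin (2 + 1) → (Matrix (Fin 2) (Fin 2) ℂ)ˣ,
                (∀ x κ, U₀ x κ ∈ specialUnitaryUnits (Fin 2)) →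
                (∀ (x : LSite (2 + 1)) (μ : Fin (2 + 1)), U₀ (x + (((PV 2 ℓ F.m K hd hL).sitesPerDir 0 : ℕ) : ℤ) • e μ) = U₀ x) →
                InAk (ℓ + 1) j (eta F n K) α₀ (fun _ => (Set.univ : Set (LSite (2 + 1)))) U₀ →
                Nonempty (KnitCubeAnalytic (mem (((PV 2 ℓ F.m K hd hL).sitesPerDir 0 : ℕ) : ℤ) j)
                  (bgY (mem (((PV 2 ℓ F.m K hd hL).sitesPerDir 0 : ℕ) : ℤ) j) U₀) b (ιBm (((PV 2 ℓ F.m K hd hL).sitesPerDir 0 : ℕ) : ℤ) j) Rr Hp p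
                  ((etaS (mem (((PV 2 ℓ F.m K hd hL).sitesPerDir 0 : ℕ) : ℤ) j) ^ 2 * etaS (mem (((PV 2 ℓ F.m K hd hL).sitesPerDir 0 : ℕ) : ℤ) j) ^ 2)⁻¹))) →
            (∀ m', m' ≤ K - n → ∀ ⦃α₀ : ℝ⦄, 0 < α₀ → α₀ ≤ cL → ∀ U₀ : LSite (2 + 1) → Fin (2 + 1) → (Matrix (Fin 2) (Fin 2) ℂ)ˣ,
                (∀ x κ, U₀ x κ ∈ specialUnitaryUnits (Fin 2)) →
                (∀ (x : LSite (2 + 1)) (μ : Fin (2 + 1)), U₀ (x + (((PV 2 ℓ F.m K hd hL).sitesPerDir 0 : ℕ) : ℤ) • e μ) = U₀ x) →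
                InAk (ℓ + 1) m' (eta F n K) α₀ (fun _ => (Set.univ : Set (LSite (2 + 1)))) U₀ →
                B9P3PerAt (𝔸 := Matrix (Fin 2) (Fin 2) ℂ) (ℓ + 1) B₀ B₀β cB9 βH len (eta F n K) m' α₀ (((PV 2 ℓ F.m K hd hL).sitesPerDir 0 : ℕ) : ℤ) U₀) →
            ∃ (β₀ B₂' : ℝ) (len' : LSite (F.P K).d → ℝ),
              Thm2SetupSUAt (F.P K) 2 (K - n) (eta F n K) β₀ B₁ B₂' c₁ len' (fun _ => True) := by
  letI : CStarAlgebra (Matrix (Fin 2) (Fin 2) ℂ) := {}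
  obtain ⟨θs, ℓs, Ds, cL, A, δG, δ₀, hθs, hℓs, hcL, hA, hδG, hδGc, hδ₀, hδ₀C, H⟩ :=
    thm2SetupSUAt_catalogued_exists_of_constants (d := 2) (ℓ := ℓ) (hd := hd) (hL := hL) (b₀ := b₀) (b₁ := b₁) (len := len) (B₀β := B₀β)
      (βH := βH) (by norm_num) (by norm_num) hℓ hb₀ hb₁ hB₀ hB hcB9 b hM₂ hrepr hBG₀ hδG₀ hNG hNG' hAE hAc hδc hBC hδC hNn hκD Rr Hp
  refine ⟨θs, ℓs, Ds, cL, A, δG, δ₀, hθs, hℓs, hcL, hA, hδG, hδGc, hδ₀, hδ₀C, fun θG ℓ₀ ℓ₁ Dsep h1 h2 h3 h4 h5 h6 h7 => ?_⟩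
  obtain ⟨p, hspec, k₀, mem, ιBm, B₁, B₂, c₁, hB₁, hB₂, hc₁, hcat, hend⟩ := H θG ℓ₀ ℓ₁ Dsep h1 h2 h3 h4 h5 h6 h7
  refine ⟨p, hspec, k₀, mem, ιBm, B₁, B₂, c₁, hB₁, hB₂, hc₁, hcat, fun F hF hm n K hnK han hb9 => ?_⟩
  have hT := hend F.m K (K - n) (eta F n K) (by omega) (by omega) (eta_pos F n K) han hb9
  rw [P_eq_PV (hd := hd) (hL := hL) F hF K]
  exact ⟨0, B₂, len, hT⟩

end Binder

end Literature.MathematicalPhysics.QuantumFieldTheory.Balaban1983to89.B8Thm2T3FamilyBinder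

end
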